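import Literature.NumberTheory.LFunctions.BCHCrossTermErrorSumsAct
import Literature.NumberTheory.LFunctions.BCHCrossMainTotal
import HarnessLib

/-!
# The cross term of the BCH mean square on `[T, 2T]`: short blocks

Topic `Literature/NumberTheory/LFunctions`. Everything in this file is PROVED (no named facts; the only
definitions are the transparent abbreviations `BCH.pairMainZ` — the pair main sum
`Σ_{k ≤ h ≤ N} a_h ā_k log(h/k)/[h,k]` — and `BCH.blockErr`, the explicit uniform error of one block).

The cross term `C(T₁,T₂) = ∫_{T₁}^{T₂} Θ² S_t² |A|² dt` of the Balasubramanian–Conrey–Heath-Brown mean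
square (named fact `Literature.Barriers.RiemannHypothesis.BalasubramanianConreyHeathBrown1985_meanSquare`)
is, on a block `[T₁, T₂]` with `T₂ ≤ 2T₁`, its stationary-phase main sum up to the weighted error
(`BCH.norm_crossTerm_sub_mainSum_le`, `BCH.weightedErrSum_le`), and the main sum is `(T₂ − T₁)·Z`
up to an error with a part of relative size `η = (T₂−T₁)/T₁` (`BCH.norm_mainSum_sub_le`). Cutting
`[T, 2T]` into `J` blocks of length `T/J` makes the relative part `O(T log³/J)` while the absolute
parts grow like `J · O(N√T log⁴ T)`:

* `BCH.norm_crossBlock_sub_le` — one block;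
* `BCH.blockErr_bound` — the block error is at most the uniform `blockErr T N B J` when
  `T ≤ T₁ ≤ T₂ ≤ 2T`, `T₂ − T₁ = T/J`;
* `BCH.norm_crossTerm_sub_le` — **`‖∫_T^{2T} Θ² S_t² |A|² dt − T·Z‖ ≤ J · blockErr T N B J`** for
  `2π ≤ T`, `2N ≤ √(T/2π)`, `J ≥ 1`, `|a_h| ≤ B`.

## References

* [Titchmarsh1986] E. C. Titchmarsh, *The Theory of the Riemann Zeta-Function*, 2nd ed. (1986), §9.22.
* [BalasubramanianConreyHeathBrown1985] J. reine angew. Math. 357 (1985), 161–181.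
-/

noncomputable section

open Finset Real Complex MeasureTheory intervalIntegral
open scoped ComplexConjugate

namespace Literature.NumberTheory.LFunctions.BCH

open Literature.NumberTheory.LFunctions.TwistedMoment

/-! ### The pair main sum `Z` -/

/-- `Z = Σ_{k ≤ h ≤ N} a_h ā_k log(h/k)/[h,k]` — the (complex, unsymmetrised) cross main coefficient.
[cite: BalasubramanianConreyHeathBrown1985, Theorem 1] -/
def pairMainZ (a : ℕ → ℂ) (N : ℕ) : ℂ :=
  ∑ h ∈ Finset.Icc 1 N, ∑ k ∈ Finset.Icc 1 N,
    (if k ≤ h then a h * conj (a k) * ((Real.log ((h : ℝ) / k) / (Nat.lcm h k : ℝ) : ℝ) : ℂ) else 0)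

/-- Unfolding `pairMainZ`. [folklore] -/
theorem pairMainZ_def (a : ℕ → ℂ) (N : ℕ) : pairMainZ a N = ∑ h ∈ Finset.Icc 1 N, ∑ k ∈ Finset.Icc 1 N,
    (if k ≤ h then a h * conj (a k) * ((Real.log ((h : ℝ) / k) / (Nat.lcm h k : ℝ) : ℝ) : ℂ) else 0) := rfl

/-! ### One block -/

/-- **The cross term on one block.** For `0 < T₁ ≤ T₂ ≤ 2T₁`, `X = ⌊√(T₂/2π)⌋`, `2N ≤ √(T₂/2π)`,
`|a_h| ≤ B`: `‖∫_{T₁}^{T₂} Θ²S_t²|A|² − (T₂−T₁) Z‖ ≤ WErr + MErr` (the bounds of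
`BCH.weightedErrSum_le` and `BCH.norm_mainSum_sub_le`). [cite: Titchmarsh1986, §9.22] -/
theorem norm_crossBlock_sub_le (a : ℕ → ℂ) (N : ℕ) {T₁ T₂ B : ℝ} (hT : 0 < T₁) (hTT' : T₁ ≤ T₂)
    (hT'2 : T₂ ≤ 2 * T₁) (hN : 2 * (N : ℝ) ≤ Real.sqrt (T₂ / (2 * π)))
    (hB : ∀ h ∈ Finset.Icc 1 N, ‖a h‖ ≤ B) :
    ‖(∫ t in T₁..T₂, thetaMainPhase t ^ 2 * (mainSum ⌊Real.sqrt (t / (2 * π))⌋₊ t) ^ 2 *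
        (((‖mollPoly a N t‖ ^ 2 : ℝ)) : ℂ)) - ((T₂ - T₁ : ℝ) : ℂ) * pairMainZ a N‖ ≤
      (4400 * B ^ 2 * N * ⌊Real.sqrt (T₂ / (2 * π))⌋₊ + 32 * (
        B ^ 2 * N * (1 + Real.log N) *
          (8 * (13 + 3 * Real.log ⌊Real.sqrt (T₂ / (2 * π))⌋₊ + 3 * Real.log (T₁ * N + 2)) *
            (1 + Real.log ⌊Real.sqrt (T₂ / (2 * π))⌋₊) * Real.sqrt (T₁ / (2 * π)) +
            24 * Real.sqrt π * ⌊Real.sqrt (T₂ / (2 * π))⌋₊)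
        + B ^ 2 * N * (1 + Real.log N) * (1 + Real.log ⌊Real.sqrt (T₂ / (2 * π))⌋₊) *
          (8 * (13 + 3 * Real.log ⌊Real.sqrt (T₂ / (2 * π))⌋₊ +
            3 * Real.log ((⌊Real.sqrt (T₂ / (2 * π))⌋₊ : ℝ) * N + 2)) * Real.sqrt (T₁ / (2 * π)) +
            24 * Real.sqrt (T₁ / 2))
        + 64 * B ^ 2 * N * Real.sqrt ⌊Real.sqrt (T₂ / (2 * π))⌋₊ * (Real.sqrt (Real.sqrt (T₁ / (2 * π))) *
          (2 * Real.sqrt π + 2 * (2 + Real.log ⌊Real.sqrt (T₂ / (2 * π))⌋₊ +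
            Real.log ((⌊Real.sqrt (T₂ / (2 * π))⌋₊ : ℝ) * N + 2))))
        + B ^ 2 * N * (1 + Real.log N) *
          (8 * (13 + 3 * Real.log ⌊Real.sqrt (T₂ / (2 * π))⌋₊ + 3 * Real.log (T₂ * N + 2)) *
            (1 + Real.log ⌊Real.sqrt (T₂ / (2 * π))⌋₊) * Real.sqrt (T₁ / (2 * π)) +
            24 * Real.sqrt π * ⌊Real.sqrt (T₂ / (2 * π))⌋₊))) +
      B ^ 2 * (2 * ((T₂ - T₁) / T₁) * (T₂ - T₁) * (1 + Real.log N) ^ 3 +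
        2 * π * N * (1 + Real.log N) *
          (7 * ((T₂ - T₁) / Real.sqrt (2 * π * T₁)) + 2 * Real.sqrt (T₂ / (2 * π)) + 2) +
        2 * π * (1 + Real.log N) * ((⌊Real.sqrt (T₂ / (2 * π))⌋₊ : ℝ) * N * (1 + Real.log N) + (N : ℝ) ^ 2)) := by
  set X := ⌊Real.sqrt (T₂ / (2 * π))⌋₊ with hX
  have h1 := norm_crossTerm_sub_mainSum_le a N hT hTT' hT'2
  have h2 := weightedErrSum_le a N X hT hTT' hT'2 hB
  have h3 := norm_mainSum_sub_le a N hT hTT' hT'2 hN hB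
  rw [← hX] at h1 h3
  rw [← pairMainZ_def] at h3
  calc _ ≤ _ + _ := norm_sub_le_norm_sub_add_norm_sub _ _ _
    _ ≤ _ := add_le_add (h1.trans h2) h3

/-! ### The uniform block error -/

/-- The uniform error of one block of `[T, 2T]` cut into `J` pieces: with `Xs = √(T/π)` (so that every
`X_j ≤ Xs`) and `G = 2TN + Xs N + Xs + 3` (an upper bound for every argument of a logarithm), the
weighted stationary-phase error and the main-sum error of a block are at most `blockErr` (same shape as
the block bound, worst-case leaves). [folklore] -/
def blockErr (T : ℝ) (N : ℕ) (B : ℝ) (J : ℕ) : ℝ :=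
  (4400 * B ^ 2 * N * Real.sqrt (T / π) + 32 * (
    B ^ 2 * N * (1 + Real.log N) *
      (8 * (13 + 3 * Real.log (2 * T * N + Real.sqrt (T / π) * N + Real.sqrt (T / π) + 3) +
        3 * Real.log (2 * T * N + Real.sqrt (T / π) * N + Real.sqrt (T / π) + 3)) *
        (1 + Real.log (2 * T * N + Real.sqrt (T / π) * N + Real.sqrt (T / π) + 3)) * Real.sqrt (T / π) +
        24 * Real.sqrt π * Real.sqrt (T / π))
    + B ^ 2 * N * (1 + Real.log N) * (1 + Real.log (2 * T * N + Real.sqrt (T / π) * N + Real.sqrt (T / π) + 3)) *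
      (8 * (13 + 3 * Real.log (2 * T * N + Real.sqrt (T / π) * N + Real.sqrt (T / π) + 3) +
        3 * Real.log (2 * T * N + Real.sqrt (T / π) * N + Real.sqrt (T / π) + 3)) * Real.sqrt (T / π) +
        24 * Real.sqrt T)
    + 64 * B ^ 2 * N * Real.sqrt (Real.sqrt (T / π)) * (Real.sqrt (Real.sqrt (T / π)) *
      (2 * Real.sqrt π + 2 * (2 + Real.log (2 * T * N + Real.sqrt (T / π) * N + Real.sqrt (T / π) + 3) +
        Real.log (2 * T * N + Real.sqrt (T / π) * N + Real.sqrt (T / π) + 3))))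
    + B ^ 2 * N * (1 + Real.log N) *
      (8 * (13 + 3 * Real.log (2 * T * N + Real.sqrt (T / π) * N + Real.sqrt (T / π) + 3) +
        3 * Real.log (2 * T * N + Real.sqrt (T / π) * N + Real.sqrt (T / π) + 3)) *
        (1 + Real.log (2 * T * N + Real.sqrt (T / π) * N + Real.sqrt (T / π) + 3)) * Real.sqrt (T / π) +
        24 * Real.sqrt π * Real.sqrt (T / π)))) +
  B ^ 2 * (2 * ((T / J) / T) * (T / J) * (1 + Real.log N) ^ 3 +
    2 * π * N * (1 + Real.log N) * (7 * ((T / J) / Real.sqrt (2 * π * T)) + 2 * Real.sqrt (2 * T / (2 * π)) + 2) +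
    2 * π * (1 + Real.log N) * (Real.sqrt (T / π) * N * (1 + Real.log N) + (N : ℝ) ^ 2))

set_option maxHeartbeats 800000 in
/-- **The block error is uniform.** For `2π ≤ T ≤ T₁ ≤ T₂ ≤ 2T` with `T₂ − T₁ = T/J`, `J ≥ 1`:
the bound of `norm_crossBlock_sub_le` is at most `blockErr T N B J`. [folklore] -/
theorem blockErr_bound {T T₁ T₂ B : ℝ} {N J : ℕ} (hT2π : 2 * π ≤ T) (hT₁ : T ≤ T₁) (hT₁₂ : T₁ ≤ T₂)
    (hT₂ : T₂ ≤ 2 * T) (hJ : 0 < J) (hΔ : T₂ - T₁ = T / J) :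
    (4400 * B ^ 2 * N * ⌊Real.sqrt (T₂ / (2 * π))⌋₊ + 32 * (
        B ^ 2 * N * (1 + Real.log N) *
          (8 * (13 + 3 * Real.log ⌊Real.sqrt (T₂ / (2 * π))⌋₊ + 3 * Real.log (T₁ * N + 2)) *
            (1 + Real.log ⌊Real.sqrt (T₂ / (2 * π))⌋₊) * Real.sqrt (T₁ / (2 * π)) +
            24 * Real.sqrt π * ⌊Real.sqrt (T₂ / (2 * π))⌋₊)
        + B ^ 2 * N * (1 + Real.log N) * (1 + Real.log ⌊Real.sqrt (T₂ / (2 * π))⌋₊) *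
          (8 * (13 + 3 * Real.log ⌊Real.sqrt (T₂ / (2 * π))⌋₊ +
            3 * Real.log ((⌊Real.sqrt (T₂ / (2 * π))⌋₊ : ℝ) * N + 2)) * Real.sqrt (T₁ / (2 * π)) +
            24 * Real.sqrt (T₁ / 2))
        + 64 * B ^ 2 * N * Real.sqrt ⌊Real.sqrt (T₂ / (2 * π))⌋₊ * (Real.sqrt (Real.sqrt (T₁ / (2 * π))) *
          (2 * Real.sqrt π + 2 * (2 + Real.log ⌊Real.sqrt (T₂ / (2 * π))⌋₊ +
            Real.log ((⌊Real.sqrt (T₂ / (2 * π))⌋₊ : ℝ) * N + 2))))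
        + B ^ 2 * N * (1 + Real.log N) *
          (8 * (13 + 3 * Real.log ⌊Real.sqrt (T₂ / (2 * π))⌋₊ + 3 * Real.log (T₂ * N + 2)) *
            (1 + Real.log ⌊Real.sqrt (T₂ / (2 * π))⌋₊) * Real.sqrt (T₁ / (2 * π)) +
            24 * Real.sqrt π * ⌊Real.sqrt (T₂ / (2 * π))⌋₊))) +
      B ^ 2 * (2 * ((T₂ - T₁) / T₁) * (T₂ - T₁) * (1 + Real.log N) ^ 3 +
        2 * π * N * (1 + Real.log N) *
          (7 * ((T₂ - T₁) / Real.sqrt (2 * π * T₁)) + 2 * Real.sqrt (T₂ / (2 * π)) + 2) +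
        2 * π * (1 + Real.log N) * ((⌊Real.sqrt (T₂ / (2 * π))⌋₊ : ℝ) * N * (1 + Real.log N) + (N : ℝ) ^ 2))
      ≤ blockErr T N B J := by
  have hπ := Real.pi_pos
  have hπ3 := Real.pi_gt_three
  have hT0 : 0 < T := by linarith
  have hT₁0 : 0 < T₁ := by linarith
  have hT₂0 : 0 < T₂ := by linarith
  have hJR : (0 : ℝ) < J := by exact_mod_cast hJ
  set X := ⌊Real.sqrt (T₂ / (2 * π))⌋₊ with hX
  set Xs := Real.sqrt (T / π) with hXs
  set G := 2 * T * N + Xs * N + Xs + 3 with hG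
  have hN0 : (0 : ℝ) ≤ N := Nat.cast_nonneg N
  have hlogN : 0 ≤ Real.log (N : ℝ) := Real.log_natCast_nonneg N
  have hXs0 : 0 < Xs := Real.sqrt_pos.2 (by positivity)
  -- `X ≤ √(T₂/2π) ≤ Xs`, `1 ≤ X`
  have hV : Real.sqrt (T₂ / (2 * π)) ≤ Xs := Real.sqrt_le_sqrt (by
    rw [div_le_div_iff₀ (by positivity) hπ]; nlinarith)
  have hXV : (X : ℝ) ≤ Real.sqrt (T₂ / (2 * π)) := Nat.floor_le (Real.sqrt_nonneg _)
  have hXXs : (X : ℝ) ≤ Xs := hXV.trans hV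
  have hX1 : 1 ≤ X := by
    rw [hX]; refine Nat.le_floor ?_
    rw [Nat.cast_one, Real.le_sqrt (by norm_num), one_pow, le_div_iff₀ (by positivity)]
    · linarith
    all_goals positivity
  have hX0R : (0 : ℝ) < X := by exact_mod_cast hX1
  have hG1 : 1 ≤ G := by rw [hG]; nlinarith
  have hG0 : 0 < G := by linarith
  have hlogG : 0 ≤ Real.log G := Real.log_nonneg hG1
  -- every logarithm is `≤ log G`
  have lX : Real.log (X : ℝ) ≤ Real.log G := Real.log_le_log hX0R (by rw [hG]; nlinarith)
  have lT₁N : Real.log (T₁ * N + 2) ≤ Real.log G :=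
    Real.log_le_log (by positivity) (by rw [hG]; nlinarith)
  have lT₂N : Real.log (T₂ * N + 2) ≤ Real.log G :=
    Real.log_le_log (by positivity) (by rw [hG]; nlinarith)
  have lXN : Real.log ((X : ℝ) * N + 2) ≤ Real.log G :=
    Real.log_le_log (by positivity) (by rw [hG]; nlinarith [mul_le_mul_of_nonneg_right hXXs hN0])
  have hlogX0 : 0 ≤ Real.log (X : ℝ) := Real.log_natCast_nonneg X
  -- square roots
  have sT₁ : Real.sqrt (T₁ / (2 * π)) ≤ Xs := Real.sqrt_le_sqrt (by
    rw [div_le_div_iff₀ (by positivity) hπ]; nlinarith)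
  have sT₁' : Real.sqrt (T₁ / 2) ≤ Real.sqrt T := Real.sqrt_le_sqrt (by linarith)
  have sX : Real.sqrt (X : ℝ) ≤ Real.sqrt Xs := Real.sqrt_le_sqrt hXXs
  have ssT₁ : Real.sqrt (Real.sqrt (T₁ / (2 * π))) ≤ Real.sqrt Xs := Real.sqrt_le_sqrt sT₁
  have hΔ0 : 0 ≤ T₂ - T₁ := by linarith
  have hΔle : T₂ - T₁ ≤ T / J := hΔ.le
  have hB2 : 0 ≤ B ^ 2 := sq_nonneg B
  have hs0 : 0 ≤ Real.sqrt π := Real.sqrt_nonneg π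
  have hlXN0 : 0 ≤ Real.log ((X : ℝ) * N + 2) := Real.log_nonneg (by nlinarith)
  have p1 : 0 ≤ 8 * (13 + 3 * Real.log (X : ℝ) + 3 * Real.log ((X : ℝ) * N + 2)) * Real.sqrt (T₁ / (2 * π)) +
      24 * Real.sqrt (T₁ / 2) :=
    add_nonneg (mul_nonneg (by linarith) (Real.sqrt_nonneg _)) (by positivity)
  have p2 : 0 ≤ 2 * Real.sqrt π + 2 * (2 + Real.log (X : ℝ) + Real.log ((X : ℝ) * N + 2)) := by linarith
  have p3 : 0 ≤ Real.sqrt (Real.sqrt (T₁ / (2 * π))) *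
      (2 * Real.sqrt π + 2 * (2 + Real.log (X : ℝ) + Real.log ((X : ℝ) * N + 2))) :=
    mul_nonneg (Real.sqrt_nonneg _) p2
  unfold blockErr
  rw [← hXs, ← hG]
  gcongr

/-! ### Summing the blocks -/

/-- **The cross term on `[T, 2T]`.** For `2π ≤ T`, `2N ≤ √(T/2π)`, `J ≥ 1`, `|a_h| ≤ B`:
`‖∫_T^{2T} Θ² S_t² |A|² dt − T·Z‖ ≤ J · blockErr T N B J` (cut `[T, 2T]` into the `J` blocks
`[T + jT/J, T + (j+1)T/J]`). [cite: Titchmarsh1986, §9.22] -/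
theorem norm_crossTerm_sub_le (a : ℕ → ℂ) (N : ℕ) {T B : ℝ} (hT2π : 2 * π ≤ T)
    (hN : 2 * (N : ℝ) ≤ Real.sqrt (T / (2 * π))) {J : ℕ} (hJ : 0 < J)
    (hB : ∀ h ∈ Finset.Icc 1 N, ‖a h‖ ≤ B) :
    ‖(∫ t in T..(2 * T), thetaMainPhase t ^ 2 * (mainSum ⌊Real.sqrt (t / (2 * π))⌋₊ t) ^ 2 *
        (((‖mollPoly a N t‖ ^ 2 : ℝ)) : ℂ)) - (T : ℂ) * pairMainZ a N‖ ≤ J * blockErr T N B J := by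
  have hπ := Real.pi_pos
  have hT0 : 0 < T := by linarith [Real.pi_gt_three]
  have hJR : (0 : ℝ) < J := by exact_mod_cast hJ
  -- the partition
  set Tj : ℕ → ℝ := fun j => T + j * (T / J) with hTj
  have hTj0 : Tj 0 = T := by simp [hTj]
  have hTjJ : Tj J = 2 * T := by simp only [hTj]; field_simp; ring
  have hTjmono : ∀ j : ℕ, Tj j ≤ Tj (j + 1) := by
    intro j; simp only [hTj]; push_cast; nlinarith [div_pos hT0 hJR]
  have hTjge : ∀ j : ℕ, T ≤ Tj j := by
    intro j; simp only [hTj]; nlinarith [div_pos hT0 hJR, (Nat.cast_nonneg j : (0:ℝ) ≤ j)]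
  have hTjpos : ∀ j : ℕ, 0 < Tj j := fun j => hT0.trans_le (hTjge j)
  have hTjΔ : ∀ j : ℕ, Tj (j + 1) - Tj j = T / J := by
    intro j; simp only [hTj]; push_cast; ring
  have hTjle : ∀ j : ℕ, j < J → Tj (j + 1) ≤ 2 * T := by
    intro j hj
    simp only [hTj]
    have : ((j + 1 : ℕ) : ℝ) ≤ J := by exact_mod_cast hj
    have h1 : ((j + 1 : ℕ) : ℝ) * (T / J) ≤ J * (T / J) := mul_le_mul_of_nonneg_right this (by positivity)
    have h2 : (J : ℝ) * (T / J) = T := by field_simp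
    push_cast at h1 ⊢
    linarith
  have hTj2 : ∀ j : ℕ, Tj (j + 1) ≤ 2 * Tj j := by
    intro j
    have h1 : Tj (j + 1) = Tj j + T / J := by linarith [hTjΔ j]
    have h2 : T / J ≤ T := div_le_self hT0.le (by exact_mod_cast hJ)
    linarith [hTjge j]
  -- the integral splits over the blocks
  set F : ℝ → ℂ := fun t => thetaMainPhase t ^ 2 * (mainSum ⌊Real.sqrt (t / (2 * π))⌋₊ t) ^ 2 *
    (((‖mollPoly a N t‖ ^ 2 : ℝ)) : ℂ) with hF
  have hsplit : (∫ t in T..(2 * T), F t) = ∑ j ∈ Finset.range J, ∫ t in Tj j..Tj (j + 1), F t := by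
    have h := intervalIntegral.sum_integral_adjacent_intervals (μ := volume) (f := F) (a := Tj) (n := J)
      fun j _ => intervalIntegrable_crossIntegrand a N (hTjpos j) (hTjmono j)
    rw [hTj0, hTjJ] at h
    exact h.symm
  have hZ : (T : ℂ) * pairMainZ a N = ∑ j ∈ Finset.range J, ((Tj (j + 1) - Tj j : ℝ) : ℂ) * pairMainZ a N := by
    simp_rw [hTjΔ]
    rw [Finset.sum_const, Finset.card_range, nsmul_eq_mul]
    have hJC : (J : ℂ) ≠ 0 := by exact_mod_cast hJ.ne'
    push_cast
    field_simp
  rw [hsplit, hZ, ← Finset.sum_sub_distrib]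
  refine (norm_sum_le _ _).trans ?_
  calc ∑ j ∈ Finset.range J, ‖(∫ t in Tj j..Tj (j + 1), F t) - ((Tj (j + 1) - Tj j : ℝ) : ℂ) * pairMainZ a N‖
      ≤ ∑ j ∈ Finset.range J, blockErr T N B J := by
        refine Finset.sum_le_sum fun j hj => ?_
        rw [Finset.mem_range] at hj
        have hNj : 2 * (N : ℝ) ≤ Real.sqrt (Tj (j + 1) / (2 * π)) :=
          hN.trans (Real.sqrt_le_sqrt (by gcongr; exact (hTjge (j + 1))))
        have h1 := norm_crossBlock_sub_le a N (hTjpos j) (hTjmono j) (hTj2 j) hNj hB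
        have h2 := blockErr_bound (B := B) (N := N) hT2π (hTjge j) (hTjmono j) (hTjle j hj) hJ (hTjΔ j)
        exact h1.trans h2
    _ = J * blockErr T N B J := by rw [Finset.sum_const, Finset.card_range, nsmul_eq_mul]

end Literature.NumberTheory.LFunctions.BCH
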